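import Mathlib

/-!
# Absorbing a perturbed finite-dimensional kernel into a coercivity estimate (abstract lemma)

Analysis/Approximation support file (everything proved, no definitions). The following piece of
"soft" linear algebra isolates the only non-explicit step in perturbing a coercivity estimate
MODULO A KERNEL. Setting: an additive group `X` (think: solutions of a perturbed linear equation
with finite energy), a data map `dat : X →+ D`, a non-negative function `N` on `D` which is a
seminorm on an additive subgroup `Adm` of admissible data (think: square root of the energy on a
half-line), a non-negative functional `Λ` on `X` (think: radiated channel energy), a subgroup
`K ≤ X` (the TRUE kernel: `Λ` does not increase when an element of `K` is subtracted — e.g. `√Λ` a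
seminorm vanishing on `K`), and a set `D₀ ⊆ Adm` (data of the kernel of the UNPERTURBED problem).
Assume
* (coercivity modulo the unperturbed kernel, up to a relative error `η`)
  `∀ x, inf_{k₀ ∈ D₀} N(dat x − k₀)² ≤ C Λ(x) + η N(dat x)²`;
* (the unperturbed kernel is `δ`-close to the true one) `∀ k₀ ∈ D₀, inf_{k ∈ K} N(k₀ − dat k) ≤ δ N(k₀)`.
Then for `η ≤ 1/18`, `δ ≤ 1/2`: `∀ x, inf_{k ∈ K} N(dat(x − k))² ≤ 18 C Λ(x)`
(`kernel_absorption`; all infima written with explicit slack `ε`). The point of the proof is to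
apply the first hypothesis not to `x` but to `x − k*` with `k* ∈ K` nearly minimising
`N(dat(x − k))`, for which `N(dat(x − k*)) ≈ inf` while `Λ(x − k*) ≤ Λ(x)`; no orthogonal
projection (no inner product, no completeness) is needed. Use: the far-side channel estimate of
`FixedModeChannels` (route PhotonSphereChannels, stmt-FinalStateConjecture-10048), where the exact
inverse-square channel estimate controls the data modulo the EXACT kernel while the statement is
about the kernel of the true (Regge–Wheeler) potential. Folklore.
-/

namespace Literature.Analysis.Approximation

open Set

/-- **Kernel absorption.** See the module docstring. [folklore] -/
theorem kernel_absorption {X D : Type*} [AddCommGroup X] [AddCommGroup D]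
    (dat : X →+ D) (N : D → ℝ) (Λ : X → ℝ) (Adm : AddSubgroup D) (K : AddSubgroup X)
    (D₀ : Set D) (hN0 : ∀ d, 0 ≤ N d) (hNneg : ∀ d ∈ Adm, N (-d) = N d)
    (hNadd : ∀ d₁ ∈ Adm, ∀ d₂ ∈ Adm, N (d₁ + d₂) ≤ N d₁ + N d₂)
    (hdat : ∀ x, dat x ∈ Adm) (hD₀ : D₀ ⊆ Adm) (hΛ0 : ∀ x, 0 ≤ Λ x)
    (hΛK : ∀ x, ∀ k ∈ K, Λ (x - k) ≤ Λ x) {C η δ : ℝ} (hC : 0 ≤ C) (hη0 : 0 ≤ η)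
    (hη : η ≤ 1 / 18) (hδ0 : 0 ≤ δ) (hδ : δ ≤ 1 / 2)
    (hexact : ∀ x, ∀ ε > (0 : ℝ), ∃ k₀ ∈ D₀,
      N (dat x - k₀) ^ 2 ≤ C * Λ x + η * N (dat x) ^ 2 + ε)
    (happrox : ∀ k₀ ∈ D₀, ∀ ε > (0 : ℝ), ∃ k ∈ K, N (k₀ - dat k) ≤ δ * N k₀ + ε) :
    ∀ x, ∀ ε > (0 : ℝ), ∃ k ∈ K, N (dat (x - k)) ^ 2 ≤ 18 * C * Λ x + ε := by
  intro x ε hε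
  -- the infimum of `N(dat(x - k))` over `k ∈ K`
  set S : Set ℝ := {r | ∃ k ∈ K, r = N (dat (x - k))} with hS
  have hSne : S.Nonempty := ⟨N (dat (x - 0)), 0, K.zero_mem, rfl⟩
  have hSbdd : BddBelow S := ⟨0, fun r ⟨k, _, hr⟩ => hr ▸ hN0 _⟩
  set Dist : ℝ := sInf S with hDist
  have hDist_le : ∀ k ∈ K, Dist ≤ N (dat (x - k)) := fun k hk => csInf_le hSbdd ⟨k, hk, rfl⟩
  have hDist0 : 0 ≤ Dist := le_csInf hSne fun r ⟨k, _, hr⟩ => hr ▸ hN0 _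
  have hDist_lt : ∀ ε₁ > (0 : ℝ), ∃ k ∈ K, N (dat (x - k)) < Dist + ε₁ := by
    intro ε₁ hε₁
    obtain ⟨r, ⟨k, hk, rfl⟩, hr⟩ := exists_lt_of_csInf_lt hSne (lt_add_of_pos_right Dist hε₁)
    exact ⟨k, hk, hr⟩
  have hDistN : Dist ≤ N (dat x) := by simpa using hDist_le 0 K.zero_mem
  ------------------------------------------------------------------
  -- main claim: `Dist² ≤ 18 C Λ x + ε₁ M` for every `ε₁ ∈ (0, 1]`
  ------------------------------------------------------------------
  set M : ℝ := 48 * N (dat x) + 45 with hM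
  have hM0 : 0 < M := by have := hN0 (dat x); positivity
  have hmain : ∀ ε₁ : ℝ, 0 < ε₁ → ε₁ ≤ 1 → Dist ^ 2 ≤ 18 * C * Λ x + ε₁ * M := by
    intro ε₁ hε₁ hε₁1
    -- a near-minimiser `k*` and the shifted element `x' = x - k*`
    obtain ⟨ks, hks, hks_lt⟩ := hDist_lt ε₁ hε₁
    set x' : X := x - ks with hx'
    set d' : D := dat x' with hd'
    have hd'A : d' ∈ Adm := hdat x'
    have hD'lt : N d' < Dist + ε₁ := hks_lt
    have hD'ge : Dist ≤ N d' := hDist_le ks hks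
    -- the exact estimate at `x'`
    obtain ⟨k₀, hk₀, hk₀_le⟩ := hexact x' ε₁ hε₁
    have hk₀A : k₀ ∈ Adm := hD₀ hk₀
    set A : ℝ := N (d' - k₀) with hA
    have hA0 : 0 ≤ A := hN0 _
    have hΛ' : Λ x' ≤ Λ x := hΛK x ks hks
    set B : ℝ := C * Λ x + η * (Dist + ε₁) ^ 2 + ε₁ with hB
    have hA2 : A ^ 2 ≤ B := by
      have h1 : η * N d' ^ 2 ≤ η * (Dist + ε₁) ^ 2 := by
        refine mul_le_mul_of_nonneg_left ?_ hη0
        exact pow_le_pow_left₀ (hN0 _) hD'lt.le 2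
      have h2 : C * Λ x' ≤ C * Λ x := mul_le_mul_of_nonneg_left hΛ' hC
      have h3 : A ^ 2 ≤ C * Λ x' + η * N d' ^ 2 + ε₁ := hk₀_le
      have h4 : B = C * Λ x + η * (Dist + ε₁) ^ 2 + ε₁ := rfl
      rw [h4]
      linarith
    -- the true-kernel approximation of `k₀`
    obtain ⟨k, hk, hk_le⟩ := happrox k₀ hk₀ ε₁ hε₁
    have hNk₀ : N k₀ ≤ A + N d' := by
      have e : k₀ = -(d' - k₀) + d' := by abel
      have hneg : N (-(d' - k₀)) = N (d' - k₀) := hNneg _ (Adm.sub_mem hd'A hk₀A)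
      calc N k₀ = N (-(d' - k₀) + d') := by rw [← e]
        _ ≤ N (-(d' - k₀)) + N d' :=
            hNadd _ (Adm.neg_mem (Adm.sub_mem hd'A hk₀A)) _ hd'A
        _ = A + N d' := by rw [hneg]
    -- `Dist ≤ N(dat(x' - k)) ≤ A + δ N k₀ + ε₁`
    have hchain : Dist ≤ A + δ * (A + N d') + ε₁ := by
      have hmem : ks + k ∈ K := K.add_mem hks hk
      have e1 : dat (x - (ks + k)) = (d' - k₀) + (k₀ - dat k) := by
        simp only [hd', hx', map_sub, map_add]; abel
      calc Dist ≤ N (dat (x - (ks + k))) := hDist_le _ hmem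
        _ = N ((d' - k₀) + (k₀ - dat k)) := by rw [e1]
        _ ≤ N (d' - k₀) + N (k₀ - dat k) :=
            hNadd _ (Adm.sub_mem hd'A hk₀A) _ (Adm.sub_mem hk₀A (hdat k))
        _ ≤ A + (δ * N k₀ + ε₁) := add_le_add le_rfl hk_le
        _ ≤ A + (δ * (A + N d') + ε₁) := by
            have := mul_le_mul_of_nonneg_left hNk₀ hδ0
            linarith
        _ = A + δ * (A + N d') + ε₁ := by ring
    -- hence `Dist ≤ 3A + 3ε₁`
    have hDist3 : Dist ≤ 3 * A + 3 * ε₁ := by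
      have h1 : δ * (A + N d') ≤ (1 / 2) * (A + (Dist + ε₁)) := by
        have hAN : 0 ≤ A + N d' := add_nonneg hA0 (hN0 _)
        calc δ * (A + N d') ≤ (1 / 2) * (A + N d') := mul_le_mul_of_nonneg_right hδ hAN
          _ ≤ (1 / 2) * (A + (Dist + ε₁)) := by
              refine mul_le_mul_of_nonneg_left ?_ (by norm_num)
              linarith [hD'lt.le]
      linarith [hchain, h1]
    -- square (two cases) and absorb
    have hB0 : 0 ≤ B := by
      have h4 : B = C * Λ x + η * (Dist + ε₁) ^ 2 + ε₁ := rfl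
      rw [h4]
      have := hΛ0 x
      positivity
    have hεD : 0 ≤ ε₁ * Dist := mul_nonneg hε₁.le hDist0
    have hsq : Dist ^ 2 ≤ 9 * B + 6 * ε₁ * Dist := by
      rcases le_or_gt Dist (3 * ε₁) with hsmall | hbig
      · have h1 : Dist * Dist ≤ 3 * ε₁ * Dist := mul_le_mul_of_nonneg_right hsmall hDist0
        have h2 : Dist ^ 2 = Dist * Dist := by ring
        rw [h2]
        linarith
      · have h0 : 0 ≤ Dist - 3 * ε₁ := by linarith
        have h1 : Dist - 3 * ε₁ ≤ 3 * A := by linarith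
        have h2 : (Dist - 3 * ε₁) ^ 2 ≤ (3 * A) ^ 2 := pow_le_pow_left₀ h0 h1 2
        have e1 : (Dist - 3 * ε₁) ^ 2 = Dist ^ 2 - 6 * ε₁ * Dist + 9 * ε₁ ^ 2 := by ring
        have e2 : (3 * A) ^ 2 = 9 * A ^ 2 := by ring
        have h3 : 0 ≤ ε₁ ^ 2 := sq_nonneg _
        rw [e1, e2] at h2
        linarith
    -- unfold `B` and use `η ≤ 1/18`, `ε₁ ≤ 1`, `Dist ≤ N (dat x)`
    have hkey : Dist ^ 2 * (1 - 9 * η) ≤ 9 * C * Λ x + ε₁ * (24 * Dist + 18) := by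
      have e : 9 * B + 6 * ε₁ * Dist = 9 * C * Λ x + 9 * η * Dist ^ 2
          + ε₁ * (18 * η * Dist + 9 * η * ε₁ + 9 + 6 * Dist) := by
        simp only [hB]; ring
      have h1 : 18 * η * Dist + 9 * η * ε₁ + 9 + 6 * Dist ≤ 24 * Dist + 18 := by
        have hη1 : η ≤ 1 := hη.trans (by norm_num)
        have i1 : η * Dist ≤ 1 * Dist := mul_le_mul_of_nonneg_right hη1 hDist0
        have i2 : η * ε₁ ≤ 1 := mul_le_one₀ hη1 hε₁.le hε₁1
        linarith
      have h2 : ε₁ * (18 * η * Dist + 9 * η * ε₁ + 9 + 6 * Dist) ≤ ε₁ * (24 * Dist + 18) :=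
        mul_le_mul_of_nonneg_left h1 hε₁.le
      have h3 : Dist ^ 2 * (1 - 9 * η) = Dist ^ 2 - 9 * η * Dist ^ 2 := by ring
      rw [h3]
      linarith
    have hhalf : (1 / 2 : ℝ) ≤ 1 - 9 * η := by linarith
    have hD2 : 0 ≤ Dist ^ 2 := sq_nonneg _
    have h3 : Dist ^ 2 * (1 / 2) ≤ 9 * C * Λ x + ε₁ * (24 * Dist + 18) :=
      (mul_le_mul_of_nonneg_left hhalf hD2).trans hkey
    have h4 : 24 * Dist + 18 ≤ M / 2 := by simp only [hM]; linarith [hDistN]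
    have h5 : ε₁ * (24 * Dist + 18) ≤ ε₁ * (M / 2) := mul_le_mul_of_nonneg_left h4 hε₁.le
    have h6 : ε₁ * (M / 2) = (ε₁ * M) / 2 := by ring
    linarith
  ------------------------------------------------------------------
  -- `Dist² ≤ 18 C Λ x`, then a kernel element within `ε`
  ------------------------------------------------------------------
  have hDist2 : Dist ^ 2 ≤ 18 * C * Λ x := by
    refine le_of_forall_pos_le_add fun ε' hε' => ?_
    set ε₁ : ℝ := min 1 (ε' / M) with hε₁
    have hε₁0 : 0 < ε₁ := lt_min zero_lt_one (div_pos hε' hM0)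
    have hε₁1 : ε₁ ≤ 1 := min_le_left _ _
    have hε₁M : ε₁ * M ≤ ε' := by
      calc ε₁ * M ≤ (ε' / M) * M := mul_le_mul_of_nonneg_right (min_le_right _ _) hM0.le
        _ = ε' := by field_simp
    linarith [hmain ε₁ hε₁0 hε₁1]
  -- choose `k` with `N(dat(x-k)) < Dist + ε₂`, `(Dist + ε₂)² ≤ Dist² + ε`
  set ε₂ : ℝ := min 1 (ε / (2 * Dist + 2)) with hε₂
  have h2D : 0 < 2 * Dist + 2 := by linarith
  have hε₂0 : 0 < ε₂ := lt_min zero_lt_one (div_pos hε h2D)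
  have hε₂1 : ε₂ ≤ 1 := min_le_left _ _
  obtain ⟨k, hk, hklt⟩ := hDist_lt ε₂ hε₂0
  refine ⟨k, hk, ?_⟩
  have hNk : 0 ≤ N (dat (x - k)) := hN0 _
  have hsq2 : N (dat (x - k)) ^ 2 ≤ (Dist + ε₂) ^ 2 := pow_le_pow_left₀ hNk hklt.le 2
  have hexp : (Dist + ε₂) ^ 2 ≤ Dist ^ 2 + ε := by
    have h1 : (Dist + ε₂) ^ 2 = Dist ^ 2 + ε₂ * (2 * Dist + ε₂) := by ring
    have h2 : ε₂ * (2 * Dist + ε₂) ≤ ε₂ * (2 * Dist + 2) :=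
      mul_le_mul_of_nonneg_left (by linarith) hε₂0.le
    have h3 : ε₂ * (2 * Dist + 2) ≤ (ε / (2 * Dist + 2)) * (2 * Dist + 2) :=
      mul_le_mul_of_nonneg_right (min_le_right _ _) h2D.le
    have h4 : (ε / (2 * Dist + 2)) * (2 * Dist + 2) = ε := by field_simp
    linarith
  linarith

end Literature.Analysis.Approximation
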